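import Summits.NavierStokesRegularity.NavierStokesRegularity.Theorems.ScaledTopAlignmentGigaMiuraTypeI
import Summits.NavierStokesRegularity.NavierStokesRegularity.Theorems.ScaledTopAlignmentBulkFatou
import Summits.NavierStokesRegularity.NavierStokesRegularity.Theorems.LocalSineTubeDoorProfileAlignedWindowRigidity
import Summits.NavierStokesRegularity.NavierStokesRegularity.Theorems.SymmetryModuliCountLiouvilleKillsTypeI
import HarnessLib

/-!
# Route `ScaledTopAlignment`: a WINDOW door suffices — scaled sign-blind alignment with ONE comparability
# ratio `λ₀ < 1` and ONE amplitude radius `R₀ > 0`, at near-maximum vorticity points, plus no Type II,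
# gives Clay (A) (support for W3 = `AprioriScaledTopAlignment`, stmt-NavierStokesRegularity-19901)

The door W3 of route `ScaledTopAlignment` asks for sign-blind alignment of the relative top set
`{λ|ω(t,x)| ≤ |ω(t,y)|}` within `R√(ν/|ω(t,x)|)` of EVERY top point, for ALL `λ ∈ (0,1)` and ALL `R > 0`;
its deciding theorem uses this to make the Type-I zoom limit's vorticity GLOBALLY sign-parallel. The sibling
route `LocalSineTubeDoor` has meanwhile landed an analyticity-based WINDOW rigidity for Type-I Oseen
profiles (`…Theorems.LocalSineTubeDoorProfileAlignedWindowRigidity.eq_zero_of_aligned_window`: a Type-I-rate,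
continuous, Oseen-mild, divergence-free field whose vorticity at ONE negative time is parallel to a fixed
`e ≠ 0` on ONE nonempty open set vanishes identically). Feeding the parabolic zoom of route
`ScaledTopAlignment` (`typeIZoom_ancientMild_limit_parabolic`) into that rigidity, the door only has to align
the zoomed vorticity on SOME small ball around a point where the limit vorticity is non-zero — which needs the
physical hypothesis only for ONE comparability ratio `λ₀ < 1` (points of a small ball have comparable limit
amplitudes), ONE radius `R₀ > 0` (a small ball has small zoomed diameter) and only at NEAR-MAXIMUM points
(`|ω(t,x)| ≥ κ/(T − t)`, by the parabolic law of the zoom). Hence the door can be weakened to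

  W3ʷ (window scaled top alignment): for every classical Leray–Hopf solution from a rapidly decaying
  datum on `[0,T)` there are `λ₀ ∈ (0,1)` and `R₀ > 0` such that for all `κ > 0`, `ε > 0` there is
  `M > 0` with: for `t ∈ (0,T)` and `x` with `|ω(t,x)| ≥ M`, `|ω(t,x)| ≥ κ/(T − t)`, every `y` with
  `λ₀|ω(t,x)| ≤ |ω(t,y)|` and `|x − y| ≤ R₀√(ν/|ω(t,x)|)` has direction sine `≤ ε`,

and this file proves **`navierStokesRegularity_of_windowScaledTopAlignment_of_noTypeII`**:
W3ʷ → NoTypeII → NavierStokesRegularity, together with `windowScaledTopAlignment_of_aprioriScaledTopAlignment`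
(W3 ⇒ W3ʷ with `λ₀ = ½`, `R₀ = 1`). Intermediate lemmas: `cross_eq_zero_of_dirSine_eq_zero` (sine zero ⇒
parallel) and `exists_window_dirSine_eq_zero_of_windowScaledTopAligned` (W3ʷ at one solution makes the limit
of a parabolic vorticity zoom sign-parallel to `Ω y₀` on a ball around any `y₀` with `Ω y₀ ≠ 0`).

An OPTION for the tenure planner (restate W3 → W3ʷ: one `λ₀`, one `R₀`, near-maximum points only); nothing
here proves W3ʷ. WHAT THIS IS NOT: not NS regularity. Cross-route edge: LocalSineTubeDoor's K2 machinery
(stmt-NavierStokesRegularity-20018) weakens ScaledTopAlignment's door.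

## References

* Y. Giga, H. Miura, Comm. Math. Phys. 303 (2011) 289–300 = HUPS #956: Thm 1.1, Rmk 1.4, §2.1. [GigaMiura2011]
* G. Koch, N. Nadirashvili, G. Seregin, V. Šverák, Acta Math. 203 (2009) 83–105, §6, Thm 5.1. [KochNadirashviliSereginSverak2009]
-/

noncomputable section

-- the summit and its single sub-problem share the name (CONVENTIONS §1), as in every Theorems file
set_option linter.dupNamespace false

open MeasureTheory Set Function Filter Topology Metric
open scoped RealInnerProductSpace

namespace Summit.NavierStokesRegularity.NavierStokesRegularity.Theorems

open Literature.Analysis Literature.Analysis.FluidPDE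
open Summit.NavierStokesRegularity.NavierStokesRegularity.Theorems.LocalSineTubeDoorProfileAlignedWindowRigidity

/-! ### Vanishing direction sine means parallel -/

/-- If the direction sine `√(1 − ⟪a/|a|, b/|b|⟫²)` of two non-zero vectors vanishes then `b × a = 0`
(equality in Cauchy–Schwarz makes `a` a multiple of `b`). [folklore] -/
theorem cross_eq_zero_of_dirSine_eq_zero {a b : EuclideanSpace ℝ (Fin 3)} (ha : a ≠ 0) (hb : b ≠ 0)
    (h : Real.sqrt (1 - (inner ℝ (‖a‖⁻¹ • a) (‖b‖⁻¹ • b)) ^ 2) = 0) : cross b a = 0 := by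
  -- `⟪a, b⟫² = ‖a‖²‖b‖²` (the Cauchy–Schwarz block of the route's deciding theorem)
  set cc : ℝ := inner ℝ (‖a‖⁻¹ • a) (‖b‖⁻¹ • b) with hcc
  have hc1 : 1 ≤ cc ^ 2 := by
    have := Real.sqrt_eq_zero'.mp h
    linarith
  have hna : ‖a‖ ≠ 0 := norm_ne_zero_iff.mpr ha
  have hnb : ‖b‖ ≠ 0 := norm_ne_zero_iff.mpr hb
  have hcval : cc = (‖a‖⁻¹ * ‖b‖⁻¹) * inner ℝ a b := by
    rw [hcc, real_inner_smul_left, real_inner_smul_right]; ring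
  have hCS : (inner ℝ a b) ^ 2 ≤ ‖a‖ ^ 2 * ‖b‖ ^ 2 := by
    have h1 := abs_real_inner_le_norm a b
    have h2 : 0 ≤ ‖a‖ * ‖b‖ := by positivity
    calc (inner ℝ a b) ^ 2 = |inner ℝ a b| ^ 2 := by rw [sq_abs]
      _ ≤ (‖a‖ * ‖b‖) ^ 2 := by nlinarith [h1, abs_nonneg (inner ℝ a b)]
      _ = ‖a‖ ^ 2 * ‖b‖ ^ 2 := by ring
  have hge : ‖a‖ ^ 2 * ‖b‖ ^ 2 ≤ (inner ℝ a b) ^ 2 := by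
    rw [hcval] at hc1
    have hpos : 0 < ‖a‖ ^ 2 * ‖b‖ ^ 2 := by positivity
    have hrew : ((‖a‖⁻¹ * ‖b‖⁻¹) * inner ℝ a b) ^ 2 = (inner ℝ a b) ^ 2 / (‖a‖ ^ 2 * ‖b‖ ^ 2) := by
      field_simp
    rw [hrew, le_div_iff₀ hpos] at hc1
    linarith
  have heq : (inner ℝ a b) ^ 2 = ‖a‖ ^ 2 * ‖b‖ ^ 2 := le_antisymm hCS hge
  obtain ⟨r, hr⟩ := exists_smul_of_inner_sq_eq hb heq
  rw [hr]
  ext i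
  fin_cases i <;> simp [cross]

/-! ### W3ʷ along a parabolic zoom: a sign-parallel window around every non-zero limit value -/

/-- **Window scaled top alignment makes the limit of a parabolic vorticity zoom sign-parallel on a ball.**
Let `ω : ℝ → ℝ³ → ℝ³` satisfy W3ʷ on `(0, T)` with constants `λ₀ ∈ (0,1)`, `R₀ > 0` (module docstring),
and let a vorticity zoom `y ↦ (λ_j²/ν) ω(t_j, x_j + λ_j y)` with `t_j ∈ [0,T)`, `t_j → T`, `λ_j → 0⁺` and
the parabolic law `λ_j² (−s) = ν (T − t_j)` (`s < 0`) converge pointwise to a CONTINUOUS `Ω` with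
`Ω y₀ ≠ 0`. Then on the open set `U = {y : λ₀|Ω y₀| < |Ω y|} ∩ B(y₀, R₀/(2√(2|Ω y₀|))) ∋ y₀` every value
`Ω y` is non-zero and sign-parallel to `Ω y₀` (direction sine `0`): for `y ∈ U` the two zoomed vorticities
are eventually `λ₀`-comparable, within the amplitude radius `R₀√(ν/|ω|)` of each other, above any
threshold and above `κ/(T − t_j)` with `κ = |Ω y₀|(−s)/2`, so W3ʷ bounds the scale-invariant sine by
every `ε > 0`. [folklore] -/
theorem exists_window_dirSine_eq_zero_of_windowScaledTopAligned {ν T : ℝ} (hν : 0 < ν) (hT : 0 < T)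
    {ω : ℝ → EuclideanSpace ℝ (Fin 3) → EuclideanSpace ℝ (Fin 3)} {lam₀ R₀ : ℝ} (hlam₀ : 0 < lam₀)
    (hlam₀1 : lam₀ < 1) (hR₀ : 0 < R₀)
    (hW : ∀ κ : ℝ, 0 < κ → ∀ ε : ℝ, 0 < ε → ∃ M : ℝ, 0 < M ∧ ∀ t ∈ Set.Ioo 0 T,
      ∀ x y : EuclideanSpace ℝ (Fin 3), M ≤ ‖ω t x‖ → κ / (T - t) ≤ ‖ω t x‖ →
        lam₀ * ‖ω t x‖ ≤ ‖ω t y‖ → ‖x - y‖ ≤ R₀ * Real.sqrt (ν / ‖ω t x‖) →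
          Real.sqrt (1 - (inner ℝ (‖ω t x‖⁻¹ • ω t x) (‖ω t y‖⁻¹ • ω t y)) ^ 2) ≤ ε)
    {s : ℝ} (hs : s < 0) {xc : ℕ → EuclideanSpace ℝ (Fin 3)} {t : ℕ → ℝ} {lam : ℕ → ℝ}
    {Ω : EuclideanSpace ℝ (Fin 3) → EuclideanSpace ℝ (Fin 3)}
    (ht : ∀ j, t j ∈ Ico 0 T) (htT : Tendsto t atTop (𝓝 T)) (hlam : ∀ j, 0 < lam j)
    (hlam0 : Tendsto lam atTop (𝓝 0)) (hpar : ∀ j, lam j ^ 2 * (-s) = ν * (T - t j))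
    (hconv : ∀ y, Tendsto (fun j => (lam j ^ 2 / ν) • ω (t j) (xc j + lam j • y)) atTop (𝓝 (Ω y)))
    (hΩ : Continuous Ω) {y₀ : EuclideanSpace ℝ (Fin 3)} (hy₀ : Ω y₀ ≠ 0) :
    ∃ U : Set (EuclideanSpace ℝ (Fin 3)), IsOpen U ∧ y₀ ∈ U ∧ ∀ y ∈ U, Ω y ≠ 0 ∧
      Real.sqrt (1 - (inner ℝ (‖Ω y₀‖⁻¹ • Ω y₀) (‖Ω y‖⁻¹ • Ω y)) ^ 2) = 0 := by
  set A := ‖Ω y₀‖ with hAdef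
  have hA : 0 < A := norm_pos_iff.mpr hy₀
  have hs2A : 0 < Real.sqrt (2 * A) := Real.sqrt_pos.2 (by linarith)
  set ρ : ℝ := R₀ / (2 * Real.sqrt (2 * A)) with hρ
  have hρ0 : 0 < ρ := by positivity
  set U : Set (EuclideanSpace ℝ (Fin 3)) := {y | lam₀ * A < ‖Ω y‖} ∩ ball y₀ ρ with hU
  have hUo : IsOpen U :=
    (isOpen_lt continuous_const (continuous_norm.comp hΩ)).inter isOpen_ball
  have hy₀U : y₀ ∈ U := by
    refine ⟨?_, mem_ball_self hρ0⟩
    show lam₀ * A < ‖Ω y₀‖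
    rw [← hAdef]
    nlinarith
  refine ⟨U, hUo, hy₀U, fun y hy => ?_⟩
  obtain ⟨hyA, hyball⟩ := hy
  change lam₀ * A < ‖Ω y‖ at hyA
  rw [mem_ball, dist_eq_norm] at hyball
  set B := ‖Ω y‖ with hBdef
  have hB : 0 < B := lt_of_le_of_lt (by positivity) hyA
  have hyne : Ω y ≠ 0 := norm_pos_iff.mp hB
  refine ⟨hyne, ?_⟩
  have hc : ∀ j, 0 < lam j ^ 2 / ν := fun j => div_pos (pow_pos (hlam j) 2) hν
  -- the sines of the zoomed vorticities converge to the sine of the limit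
  have hlim : Tendsto (fun j => Real.sqrt (1 - (inner ℝ
      (‖(lam j ^ 2 / ν) • ω (t j) (xc j + lam j • y₀)‖⁻¹ • ((lam j ^ 2 / ν) • ω (t j) (xc j + lam j • y₀)))
      (‖(lam j ^ 2 / ν) • ω (t j) (xc j + lam j • y)‖⁻¹ • ((lam j ^ 2 / ν) • ω (t j) (xc j + lam j • y)))) ^ 2))
      atTop (𝓝 (Real.sqrt (1 - (inner ℝ (‖Ω y₀‖⁻¹ • Ω y₀) (‖Ω y‖⁻¹ • Ω y)) ^ 2))) :=
    tendsto_dirSine hy₀ hyne (hconv y₀) (hconv y)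
  refine le_antisymm ?_ (dirSine_nonneg _ _)
  refine le_of_forall_pos_le_add fun ε hε => ?_
  rw [zero_add]
  refine le_of_tendsto hlim ?_
  -- norms along the zoom
  have hnA : Tendsto (fun j => ‖(lam j ^ 2 / ν) • ω (t j) (xc j + lam j • y₀)‖) atTop (𝓝 A) :=
    (hconv y₀).norm
  have hnB : Tendsto (fun j => ‖(lam j ^ 2 / ν) • ω (t j) (xc j + lam j • y)‖) atTop (𝓝 B) :=
    (hconv y).norm
  have e1 : ∀ᶠ j in atTop, ‖(lam j ^ 2 / ν) • ω (t j) (xc j + lam j • y₀)‖ < 2 * A :=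
    hnA.eventually_lt_const (by linarith)
  have e2 : ∀ᶠ j in atTop, A / 2 < ‖(lam j ^ 2 / ν) • ω (t j) (xc j + lam j • y₀)‖ :=
    hnA.eventually_const_lt (by linarith)
  -- `λ₀`-comparability, eventually (the limit amplitudes satisfy `λ₀ A < B`)
  have e3 : ∀ᶠ j in atTop, 0 < ‖(lam j ^ 2 / ν) • ω (t j) (xc j + lam j • y)‖ -
      lam₀ * ‖(lam j ^ 2 / ν) • ω (t j) (xc j + lam j • y₀)‖ :=
    (hnB.sub (hnA.const_mul lam₀)).eventually_const_lt (by linarith)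
  -- the parameters fed to W3ʷ
  set κ : ℝ := A * (-s) / 2 with hκ
  have hκ0 : 0 < κ := by have := neg_pos.2 hs; positivity
  obtain ⟨M, hM0, hM⟩ := hW κ hκ0 ε hε
  have e4 : ∀ᶠ j in atTop, lam j < Real.sqrt (A * ν / (2 * M)) :=
    hlam0.eventually_lt_const (Real.sqrt_pos.mpr (by positivity))
  have e5 : ∀ᶠ j in atTop, 0 < t j := htT.eventually_const_lt hT
  filter_upwards [e1, e2, e3, e4, e5] with j h1 h2 h3 h4 h5
  set c := lam j ^ 2 / ν with hcdef
  have hcj : 0 < c := hc j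
  set a := ω (t j) (xc j + lam j • y₀) with hadef
  set b := ω (t j) (xc j + lam j • y) with hbdef
  have hna : ‖c • a‖ = c * ‖a‖ := by rw [norm_smul, Real.norm_of_nonneg hcj.le]
  have hnb : ‖c • b‖ = c * ‖b‖ := by rw [norm_smul, Real.norm_of_nonneg hcj.le]
  rw [hna] at h1 h2 h3
  rw [hnb] at h3
  have hTt : 0 < T - t j := sub_pos.2 (ht j).2
  -- above the threshold `M`
  have hlam2 : lam j ^ 2 < A * ν / (2 * M) := by
    have h0 : 0 ≤ lam j := (hlam j).le
    calc lam j ^ 2 = lam j * lam j := by ring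
      _ < Real.sqrt (A * ν / (2 * M)) * Real.sqrt (A * ν / (2 * M)) :=
          mul_lt_mul'' h4 h4 h0 h0
      _ = A * ν / (2 * M) := Real.mul_self_sqrt (by positivity)
  have hcle' : c ≤ A / (2 * M) := by
    rw [hcdef, div_le_iff₀ hν]
    have hr : A / (2 * M) * ν = A * ν / (2 * M) := by ring
    rw [hr]; exact hlam2.le
  have hMa : M ≤ ‖a‖ := by
    have hapos : 0 ≤ ‖a‖ := norm_nonneg _
    have h6 : A / 2 < A / (2 * M) * ‖a‖ := lt_of_lt_of_le h2 (mul_le_mul_of_nonneg_right hcle' hapos)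
    have h7 : M * (A / 2) < M * (A / (2 * M) * ‖a‖) := mul_lt_mul_of_pos_left h6 hM0
    have hsimp : M * (A / (2 * M) * ‖a‖) = A / 2 * ‖a‖ := by field_simp
    rw [hsimp] at h7
    have hA2 : 0 < A / 2 := by linarith
    nlinarith
  -- NEAR-MAXIMUM: `κ/(T − t_j) ≤ |a|` by the parabolic law
  have hκa : κ / (T - t j) ≤ ‖a‖ := by
    rw [div_le_iff₀ hTt, hκ]
    have hTeq : T - t j = lam j ^ 2 * (-s) / ν := by
      rw [hpar j]; field_simp
    rw [hTeq]
    have hs' : 0 < -s := neg_pos.2 hs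
    have : A / 2 * (-s) < c * ‖a‖ * (-s) := mul_lt_mul_of_pos_right h2 hs'
    have e : ‖a‖ * (lam j ^ 2 * (-s) / ν) = c * ‖a‖ * (-s) := by rw [hcdef]; ring
    rw [e]
    linarith
  -- `λ₀`-comparable amplitudes
  have hlamab : lam₀ * ‖a‖ ≤ ‖b‖ := by
    have h8 : c * (lam₀ * ‖a‖) < c * ‖b‖ := by nlinarith [h3]
    exact (lt_of_mul_lt_mul_left h8 hcj.le).le
  -- within the amplitude radius `R₀ √(ν/|a|)`
  have hdist : ‖(xc j + lam j • y₀) - (xc j + lam j • y)‖ ≤ R₀ * Real.sqrt (ν / ‖a‖) := by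
    have hxy : (xc j + lam j • y₀) - (xc j + lam j • y) = lam j • (y₀ - y) := by
      rw [smul_sub]; abel
    rw [hxy, norm_smul, Real.norm_of_nonneg (hlam j).le]
    have hapos : 0 < ‖a‖ := lt_of_lt_of_le hM0 hMa
    have hq : lam j ^ 2 / (2 * A) ≤ ν / ‖a‖ := by
      rw [div_le_div_iff₀ (by positivity) hapos]
      have ha2 : c * ‖a‖ < 2 * A := h1
      rw [hcdef] at ha2
      have : lam j ^ 2 * ‖a‖ < 2 * A * ν := by
        have := (div_mul_eq_mul_div (lam j ^ 2) ν ‖a‖).symm ▸ ha2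
        rwa [div_lt_iff₀ hν] at this
      linarith
    have hsq : lam j / Real.sqrt (2 * A) ≤ Real.sqrt (ν / ‖a‖) := by
      have : Real.sqrt (lam j ^ 2 / (2 * A)) = lam j / Real.sqrt (2 * A) := by
        rw [Real.sqrt_div' _ , Real.sqrt_sq (hlam j).le]
        positivity
      rw [← this]; exact Real.sqrt_le_sqrt hq
    have hyy : ‖y₀ - y‖ < ρ := by rw [norm_sub_rev]; exact hyball
    have hρle : ρ ≤ R₀ / Real.sqrt (2 * A) := by
      rw [hρ, div_le_div_iff_of_pos_left hR₀ (by positivity) hs2A]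
      linarith
    calc lam j * ‖y₀ - y‖ ≤ lam j * (R₀ / Real.sqrt (2 * A)) :=
          mul_le_mul_of_nonneg_left (hyy.le.trans hρle) (hlam j).le
      _ = R₀ * (lam j / Real.sqrt (2 * A)) := by ring
      _ ≤ R₀ * Real.sqrt (ν / ‖a‖) := mul_le_mul_of_nonneg_left hsq hR₀.le
  -- W3ʷ at the pair, and scale invariance of the sine
  have hfin : Real.sqrt (1 - (inner ℝ (‖a‖⁻¹ • a) (‖b‖⁻¹ • b)) ^ 2) ≤ ε :=
    hM (t j) ⟨h5, (ht j).2⟩ _ _ hMa hκa hlamab hdist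
  rw [dirSine_smul_pos hcj]
  exact hfin

/-! ### The bridge: W3ʷ + NoTypeII ⇒ Clay (A) -/

/-- **Window scaled top alignment plus no Type II gives Clay (A).** If every classical Leray–Hopf solution
from a rapidly decaying datum satisfies W3ʷ (module docstring: sign-blind alignment with ONE comparability
ratio `λ₀ ∈ (0,1)` and ONE amplitude radius `R₀ > 0`, required only above a threshold and at near-maximum
points `|ω(t,x)| ≥ κ/(T − t)`, for all `κ, ε > 0`) and the route's residual hard core NoTypeII holds, then
`NavierStokesRegularity`. Proof: `TypeILiouville.Assembly_holds` reduces (A) to «no blow-up»; a maximal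
solution blowing up at `T` is Type I (NoTypeII) and bounded on closed sub-strips
(`liouvilleKillsTypeI_exists_bound_Icc`); its parabolic Type-I zoom limit `W`
(`typeIZoom_ancientMild_limit_parabolic`) is a non-trivial Type-I ancient mild field. If every slice
vorticity of `W` vanished, `W ≡ 0` by U (`ancientMild_sliceAlignedVorticity_trivial`); otherwise some
`curl W(s₀)(y₀) ≠ 0`, W3ʷ makes `curl W(s₀)` parallel to `curl W(s₀)(y₀)` on a ball around `y₀`
(`exists_window_dirSine_eq_zero_of_windowScaledTopAligned`, `cross_eq_zero_of_dirSine_eq_zero`), and the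
window rigidity of route LocalSineTubeDoor (`eq_zero_of_aligned_window`: slice analyticity + identity
theorem + Giga–Miura 2D reduction + KNSS planar Liouville + backward uniqueness) forces `W ≡ 0` — either
way contradicting `W(−1,0) ≠ 0`. [cite: GigaMiura2011, Thm 1.1 with Rmk 1.4 and §2.1 (HUPS preprint #956 pp. 3–9)] -/
theorem navierStokesRegularity_of_windowScaledTopAlignment_of_noTypeII
    (hW : ∀ (ν T : ℝ), 0 < ν → 0 < T → ∀ (u : ℝ → EuclideanSpace ℝ (Fin 3) → EuclideanSpace ℝ (Fin 3))
      (p : ℝ → EuclideanSpace ℝ (Fin 3) → ℝ),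
      Literature.Analysis.FluidPDE.IsClassicalNSSolutionOn (Set.Ico 0 T) ν 0 u p →
      Literature.Analysis.FluidPDE.IsLerayHopfOn T ν 0 (u 0) u →
      Literature.Analysis.FluidPDE.HasRapidSpatialDecay (u 0) →
      ∃ lam₀ : ℝ, 0 < lam₀ ∧ lam₀ < 1 ∧ ∃ R₀ : ℝ, 0 < R₀ ∧
      ∀ κ : ℝ, 0 < κ → ∀ ε : ℝ, 0 < ε →
      ∃ M : ℝ, 0 < M ∧ ∀ t ∈ Set.Ioo 0 T, ∀ x y : EuclideanSpace ℝ (Fin 3),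
        M ≤ ‖Literature.Analysis.FluidPDE.curl (u t) x‖ →
        κ / (T - t) ≤ ‖Literature.Analysis.FluidPDE.curl (u t) x‖ →
        lam₀ * ‖Literature.Analysis.FluidPDE.curl (u t) x‖ ≤ ‖Literature.Analysis.FluidPDE.curl (u t) y‖ →
        ‖x - y‖ ≤ R₀ * Real.sqrt (ν / ‖Literature.Analysis.FluidPDE.curl (u t) x‖) →
          Real.sqrt (1 - (inner ℝ (‖Literature.Analysis.FluidPDE.curl (u t) x‖⁻¹ •
              Literature.Analysis.FluidPDE.curl (u t) x)
            (‖Literature.Analysis.FluidPDE.curl (u t) y‖⁻¹ • Literature.Analysis.FluidPDE.curl (u t) y)) ^ 2)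
            ≤ ε)
    (hII : Summit.NavierStokesRegularity.NavierStokesRegularity.Theses.ScaledTopAlignment.NoTypeII) :
    _root_.NavierStokesRegularity := by
  apply Summit.NavierStokesRegularity.NavierStokesRegularity.Theses.TypeILiouville.Assembly_holds
  intro ν T hν hT u p hcl hLH hdec
  by_contra hext
  have hmax : Literature.Analysis.FluidPDE.IsMaximalSmoothSolution ν 0 u p T := ⟨hcl, hext⟩
  have hI : Literature.Analysis.FluidPDE.IsTypeIBlowup u T := hII ν T hν hT u p hmax hLH hdec
  have hbdd : ∀ T' < T, ∃ M : ℝ, ∀ s ∈ Set.Icc 0 T', ∀ x, ‖u s x‖ ≤ M := by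
    intro T' hT'
    by_cases h : 0 < T'
    · exact liouvilleKillsTypeI_exists_bound_Icc hν hcl hLH hdec ⟨h, hT'⟩
    · obtain ⟨M, hM⟩ := liouvilleKillsTypeI_exists_bound_Icc hν hcl hLH hdec (T' := T / 2)
        ⟨by linarith, by linarith⟩
      push Not at h
      exact ⟨M, fun s hs x => hM s ⟨hs.1, by linarith [hs.2]⟩ x⟩
  obtain ⟨C, W, hWcl, hW0, hzoom⟩ :=
    typeIZoom_ancientMild_limit_parabolic hν hT hcl hLH hbdd hI hext
  obtain ⟨lam₀, hlam₀, hlam₀1, R₀, hR₀, hfam⟩ := hW ν T hν hT u p hcl hLH hdec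
  by_cases hall : ∀ s < (0 : ℝ), ∀ y, curl (W s) y = 0
  · -- every slice vorticity vanishes: U kills `W`
    exact hW0 (ancientMild_sliceAlignedVorticity_trivial hWcl (fun s hs => Or.inl (hall s hs))
      (-1) (by norm_num) 0)
  · -- some slice vorticity is non-zero somewhere: window alignment + window rigidity kill `W`
    push Not at hall
    obtain ⟨s₀, hs₀, y₀, hy₀⟩ := hall
    obtain ⟨xc, t, lam, ht, htT, hlam, hlam0, hpar, hconv⟩ := hzoom s₀ hs₀
    have hcont : Continuous (curl (W s₀)) :=
      continuous_curl ((hWcl.contDiff_slice hs₀).of_le (by exact_mod_cast le_top))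
    obtain ⟨U, hUo, hy₀U, hU⟩ :=
      exists_window_dirSine_eq_zero_of_windowScaledTopAligned hν hT (ω := fun τ => curl (u τ))
        hlam₀ hlam₀1 hR₀ hfam hs₀ ht htT hlam hlam0 hpar hconv hcont hy₀
    have hal : ∀ y ∈ U, cross (curl (W s₀) y) (curl (W s₀) y₀) = 0 := fun y hy =>
      cross_eq_zero_of_dirSine_eq_zero hy₀ (hU y hy).1 (hU y hy).2
    exact hW0 (eq_zero_of_aligned_window hWcl.hasTypeITimeDecay hWcl.continuousOn_uncurry
      (fun s t hst ht' x => hWcl.mild_eq_heatExtension hst ht' x) (fun t ht' => hWcl.isDivFree ht')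
      hs₀ hy₀ hUo ⟨y₀, hy₀U⟩ hal (-1) (by norm_num) 0)

/-- **W3 ⇒ W3ʷ**: the route's door `AprioriScaledTopAlignment` (stmt-NavierStokesRegularity-19901) implies
the window door (take `λ₀ = ½`, `R₀ = 1`; drop the near-maximum hypothesis; restrict `t` to `(0,T)`).
[folklore] -/
theorem windowScaledTopAlignment_of_aprioriScaledTopAlignment
    (hW3 : Summit.NavierStokesRegularity.NavierStokesRegularity.Theses.ScaledTopAlignment.AprioriScaledTopAlignment) :
    ∀ (ν T : ℝ), 0 < ν → 0 < T → ∀ (u : ℝ → EuclideanSpace ℝ (Fin 3) → EuclideanSpace ℝ (Fin 3))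
      (p : ℝ → EuclideanSpace ℝ (Fin 3) → ℝ),
      Literature.Analysis.FluidPDE.IsClassicalNSSolutionOn (Set.Ico 0 T) ν 0 u p →
      Literature.Analysis.FluidPDE.IsLerayHopfOn T ν 0 (u 0) u →
      Literature.Analysis.FluidPDE.HasRapidSpatialDecay (u 0) →
      ∃ lam₀ : ℝ, 0 < lam₀ ∧ lam₀ < 1 ∧ ∃ R₀ : ℝ, 0 < R₀ ∧
      ∀ κ : ℝ, 0 < κ → ∀ ε : ℝ, 0 < ε →
      ∃ M : ℝ, 0 < M ∧ ∀ t ∈ Set.Ioo 0 T, ∀ x y : EuclideanSpace ℝ (Fin 3),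
        M ≤ ‖Literature.Analysis.FluidPDE.curl (u t) x‖ →
        κ / (T - t) ≤ ‖Literature.Analysis.FluidPDE.curl (u t) x‖ →
        lam₀ * ‖Literature.Analysis.FluidPDE.curl (u t) x‖ ≤ ‖Literature.Analysis.FluidPDE.curl (u t) y‖ →
        ‖x - y‖ ≤ R₀ * Real.sqrt (ν / ‖Literature.Analysis.FluidPDE.curl (u t) x‖) →
          Real.sqrt (1 - (inner ℝ (‖Literature.Analysis.FluidPDE.curl (u t) x‖⁻¹ •
              Literature.Analysis.FluidPDE.curl (u t) x)
            (‖Literature.Analysis.FluidPDE.curl (u t) y‖⁻¹ • Literature.Analysis.FluidPDE.curl (u t) y)) ^ 2)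
            ≤ ε := by
  intro ν T hν hT u p hcl hLH hdec
  refine ⟨1 / 2, by norm_num, by norm_num, 1, one_pos, fun κ _hκ ε hε => ?_⟩
  obtain ⟨M, hM, h⟩ := hW3 ν T hν hT u p hcl hLH hdec (1 / 2) (by norm_num) (by norm_num) 1 one_pos ε hε
  exact ⟨M, hM, fun t ht x y hMx _hκx hlamy hxy => h t ⟨ht.1.le, ht.2⟩ x y hMx hlamy hxy⟩

end Summit.NavierStokesRegularity.NavierStokesRegularity.Theorems

end
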